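import Literature.NumberTheory.IwasawaTheory.ClassicalMuVanishesRelativeKleinDescent
import HarnessLib

set_option autoImplicit false

/-!
# Growth-fact-free and Ferrero–Washington-free μ-descent for Galois groups of non-split-Cartan-normaliser type
# `N_ns(5) = C₂₄ ⋊ C₂` (e.g. `ℚ(E[5])` with mod-5 image `C_ns⁺(5)`)

Topic `NumberTheory/IwasawaTheory` (namespace = path).  THEOREM-ONLY file (no definition, no named fact, no `sorry`); literature
seat `bsd-potss-conjA-anchor` g12 (supports stmt-BirchSwinnertonDyer-19413, KT rows with non-split Cartan normaliser image at `p = 5`,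
typed «structurally void» by the g10 norm-relation census; closes nothing).

`L/ℚ` finite Galois, `p` odd, `p ∤ [L : ℚ]`, and `x, s ∈ G = Gal(L/ℚ)` with the relations of `C_ns⁺(5) ⊂ GL₂(𝔽₅)`
(`x` a generator of `C_ns(5) = 𝔽₂₅ˣ ≅ C₂₄`, `s` the Frobenius-type involution): `x²⁴ = 1`, `s² = 1`, `s x s⁻¹ = x⁵`.  Then
«`μ = 0` for every cyclotomic `ℤ_p`-extension of `L`» follows — with NO named fact at all (no growth theorem, no Ferrero–Washington) —
from the same statement for the SEVEN fixed fields

  `L^{⟨s⟩}` (`= ℚ(P)`, degree 24), `L^{⟨x¹², s⟩}` (`= ℚ(x P)`, 12), `L^{⟨x⁶s⟩}` (12), `L^{⟨x³⟩}` (6, the `S₃`-sextic),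
  `L^{⟨x⁶, s⟩}` (6), `L^{⟨x⁶, x³s⟩}` (6), `L^{⟨x³, s⟩}` (3, the cubic subfield).

Road (three RELATIVE Klein steps `classicalMuVanishes_of_isCyclotomic_of_relative_biquadratic`, each a Kuroda EQUALITY at every layer of
the cyclotomic tower, [Lemmermeyer1994] §1):
(3) `N = ⟨x⁶⟩` with `x³, s` (`(x³)² = x⁶`, `[x³, s] = x⁻¹² ∈ N`): `μ(L^{⟨x⁶⟩})` from `L^{⟨x³⟩}`, `L^{⟨x⁶,s⟩}`, `L^{⟨x⁶,x³s⟩}`, `L^{⟨x³,s⟩}`;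
(2) `N = ⟨x¹²⟩` (central) with `x⁶, s` (`[x⁶, s] = 1`): `μ(L^{⟨x¹²⟩})` from `L^{⟨x⁶⟩}`, `L^{⟨x¹²,s⟩}`, `L^{⟨x⁶s⟩}` (`(x⁶s)² = x¹²`), `L^{⟨x⁶,s⟩}`;
(1) `N = 1` with `x¹², s`: `μ(L)` from `L^{⟨x¹²⟩}`, `L^{⟨s⟩}`, `L^{⟨x¹²s⟩} ≅ L^{⟨s⟩}` (`x¹²s = x³ s x⁻³`), `L^{⟨x¹²,s⟩}`.
The seven inputs are what the unit norm-index door (`ClassicalMuVanishesUnitNormIndex.lean`), Iwasawa 1956 or Fukuda 1994 decide per row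
from class-group numerics of fields of degree ≤ 24.

References: [Lemmermeyer1994, §1]; [Washington1997, §13.1]; [MilneFT2022, Ch. 3]; [Serre1972, §2 (Cartan subgroups and their normalisers)].
-/

noncomputable section

open scoped NumberField

open Field IntermediateField Literature.NumberTheory.EllipticCurves

namespace Literature.NumberTheory.IwasawaTheory

variable {p : ℕ} [Fact p.Prime]

omit [Fact p.Prime] in
/-- `p ∤ [E : ℚ]` for an intermediate field `E` of `L/ℚ` when `p ∤ [L : ℚ]`. [folklore] -/
private theorem not_dvd_finrank_intermediateField₆ {L : Type} [Field L] [NumberField L]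
    (hp : ¬ p ∣ Module.finrank ℚ L) (E : IntermediateField ℚ L) : ¬ p ∣ Module.finrank ℚ ↥E := fun h =>
  hp (h.trans (Dvd.intro _ (Module.finrank_mul_finrank ℚ ↥E L)))

omit [Fact p.Prime] in
/-- An element commuting with `h` normalises `⟨h⟩`. [folklore] -/
private theorem mem_normalizer_zpowers_of_commute₆ {G : Type} [Group G] {g h : G} (hc : Commute g h) :
    g ∈ Subgroup.normalizer (Subgroup.zpowers h : Set G) := by
  rw [Subgroup.mem_normalizer_iff]
  intro k
  constructor
  · intro hk
    obtain ⟨m, rfl⟩ := Subgroup.mem_zpowers_iff.mp hk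
    rw [(hc.zpow_right m).eq, mul_inv_cancel_right]
    exact hk
  · intro hk
    obtain ⟨m, hm⟩ := Subgroup.mem_zpowers_iff.mp hk
    have h1 : k = g⁻¹ * h ^ m * g := by rw [hm]; group
    rw [h1, (hc.inv_left.zpow_right m).eq, inv_mul_cancel_right]
    exact Subgroup.zpow_mem _ (Subgroup.mem_zpowers h) m

omit [Fact p.Prime] in
/-- Everything normalises the trivial subgroup. [folklore] -/
private theorem mem_normalizer_bot₆ {G : Type} [Group G] (g : G) :
    g ∈ Subgroup.normalizer ((⊥ : Subgroup G) : Set G) := by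
  rw [Subgroup.mem_normalizer_iff]
  intro k
  simp only [Subgroup.mem_bot]
  constructor
  · intro hk; rw [hk, mul_one, mul_inv_cancel]
  · intro hk
    have : k = g⁻¹ * (g * k * g⁻¹) * g := by group
    rw [this, hk, mul_one, inv_mul_cancel]

/-- Transport of «`μ = 0` for every cyclotomic `ℤ_p`-extension» between fixed fields of EQUAL subgroups. [folklore] -/
private theorem forall_classicalMuVanishes_of_subgroup_eq₆ {L : Type} [Field L] [NumberField L]
    (hp : ¬ p ∣ Module.finrank ℚ L) {S T : Subgroup (L ≃ₐ[ℚ] L)} (hST : S = T)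
    (h : ∀ κE : ZpExtension ↥(fixedField S) p, κE.IsCyclotomic → ClassicalMuVanishes κE) :
    ∀ κE : ZpExtension ↥(fixedField T) p, κE.IsCyclotomic → ClassicalMuVanishes κE :=
  forall_classicalMuVanishes_of_algEquiv (F := ℚ) (IntermediateField.equivOfEq (congrArg fixedField hST))
    (not_dvd_finrank_intermediateField₆ hp _) h

/-- Transport along conjugation: `L^{g S g⁻¹}` from `L^S`. [folklore] -/
private theorem forall_classicalMuVanishes_of_conj₆ {L : Type} [Field L] [NumberField L]
    (hp : ¬ p ∣ Module.finrank ℚ L) (S T : Subgroup (L ≃ₐ[ℚ] L)) (g : L ≃ₐ[ℚ] L)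
    (hST : S.map (MulAut.conj g).toMonoidHom = T)
    (h : ∀ κE : ZpExtension ↥(fixedField S) p, κE.IsCyclotomic → ClassicalMuVanishes κE) :
    ∀ κE : ZpExtension ↥(fixedField T) p, κE.IsCyclotomic → ClassicalMuVanishes κE := by
  haveI : FiniteDimensional ℚ L := inferInstance
  obtain ⟨φ⟩ := nonempty_algEquiv_fixedField_conj (F := ℚ) S g
  exact forall_classicalMuVanishes_of_algEquiv (F := ℚ) (φ.trans (IntermediateField.equivOfEq (congrArg fixedField hST)))
    (not_dvd_finrank_intermediateField₆ hp _) h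

omit [Fact p.Prime] in
/-- `⟨a⟩ ⊔ ⟨b⟩ = ⟨b⟩` when `a ∈ ⟨b⟩`. [folklore] -/
private theorem zpowers_sup_eq_of_mem {G : Type} [Group G] {a b : G} (h : a ∈ Subgroup.zpowers b) :
    Subgroup.zpowers a ⊔ Subgroup.zpowers b = Subgroup.zpowers b :=
  sup_eq_right.mpr ((Subgroup.zpowers_le).mpr h)

omit [Fact p.Prime] in
/-- Powers of a conjugate: `s xⁿ s⁻¹ = (s x s⁻¹)ⁿ`. [folklore] -/
private theorem conj_pow₆ {G : Type} [Group G] (s x : G) (n : ℕ) : s * x ^ n * s⁻¹ = (s * x * s⁻¹) ^ n := by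
  rw [← MulAut.conj_apply, map_pow, MulAut.conj_apply]

set_option maxHeartbeats 1600000 in
/-- **The `N_ns(5) = C₂₄ ⋊ C₂` census form, fact-free: `μ(L) = 0` from seven small fixed fields.**  `L/ℚ` finite Galois, `p` odd,
`p ∤ [L:ℚ]`; `x, s ∈ Gal(L/ℚ)` with `x²⁴ = 1`, `s² = 1`, `s x s⁻¹ = x⁵` (the presentation of the normaliser of the non-split Cartan
subgroup of `GL₂(𝔽₅)`: `x` generates `C_ns(5) ≅ 𝔽₂₅ˣ`, `s` acts as Frobenius).  If «`μ = 0` for every cyclotomic `ℤ_p`-extension» holds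
for the fixed fields of `⟨s⟩`, `⟨x¹², s⟩`, `⟨x⁶s⟩`, `⟨x³⟩`, `⟨x⁶, s⟩`, `⟨x⁶, x³s⟩`, `⟨x³, s⟩`, then it holds for `L`.  For `L = ℚ(E[5])` with
image `C_ns⁺(5)`: `L^{⟨s⟩} = ℚ(P)` (degree 24), `L^{⟨x¹²,s⟩} = ℚ(x P)` (12), and fields of degree 12, 6, 6, 6, 3.  Three relative Klein
steps (module docstring); NO named fact is used. [cite: Lemmermeyer1994, §1 (Kuroda's class number formula, odd part)]
[cite: Washington1997, §13.1] [cite: MilneFT2022, Ch. 3 (Galois correspondence)] [cite: Serre1972, §2.2 (C_ns and its normaliser)] -/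
theorem classicalMuVanishes_of_isCyclotomic_of_nonsplitCartanFive_kuroda_rat (hp2 : p ≠ 2)
    (L : Type) [Field L] [NumberField L] [IsGalois ℚ L] (hp : ¬ p ∣ Module.finrank ℚ L)
    {x s : L ≃ₐ[ℚ] L} (hx : x ^ 24 = 1) (hs : s * s = 1) (hsx : s * x * s⁻¹ = x ^ 5)
    (hμP : ∀ κE : ZpExtension ↥(fixedField (Subgroup.zpowers s)) p, κE.IsCyclotomic → ClassicalMuVanishes κE)
    (hμB₁ : ∀ κE : ZpExtension ↥(fixedField (Subgroup.zpowers (x ^ 12) ⊔ Subgroup.zpowers s)) p,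
      κE.IsCyclotomic → ClassicalMuVanishes κE)
    (hμB₁' : ∀ κE : ZpExtension ↥(fixedField (Subgroup.zpowers (x ^ 6 * s))) p, κE.IsCyclotomic → ClassicalMuVanishes κE)
    (hμS : ∀ κE : ZpExtension ↥(fixedField (Subgroup.zpowers (x ^ 3))) p, κE.IsCyclotomic → ClassicalMuVanishes κE)
    (hμB₂ : ∀ κE : ZpExtension ↥(fixedField (Subgroup.zpowers (x ^ 6) ⊔ Subgroup.zpowers s)) p,
      κE.IsCyclotomic → ClassicalMuVanishes κE)
    (hμB₂' : ∀ κE : ZpExtension ↥(fixedField (Subgroup.zpowers (x ^ 6) ⊔ Subgroup.zpowers (x ^ 3 * s))) p,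
      κE.IsCyclotomic → ClassicalMuVanishes κE)
    (hμB₃ : ∀ κE : ZpExtension ↥(fixedField (Subgroup.zpowers (x ^ 3) ⊔ Subgroup.zpowers s)) p,
      κE.IsCyclotomic → ClassicalMuVanishes κE)
    (κL : ZpExtension L p) (hκL : κL.IsCyclotomic) : ClassicalMuVanishes κL := by
  haveI : FiniteDimensional ℚ L := inferInstance
  -- bookkeeping in the cyclic group `⟨x⟩`
  have hsxn : ∀ n : ℕ, s * x ^ n * s⁻¹ = x ^ (5 * n) := fun n => by rw [conj_pow₆, hsx, ← pow_mul]
  have hxpow : ∀ n : ℕ, x ^ n = x ^ (n % 24) := fun n => by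
    conv_lhs => rw [← Nat.mod_add_div n 24, pow_add, pow_mul, hx, one_pow, mul_one]
  have hsx6 : s * x ^ 6 * s⁻¹ = x ^ 6 := by rw [hsxn, hxpow (5 * 6)]
  have hsx12 : s * x ^ 12 * s⁻¹ = x ^ 12 := by rw [hsxn, hxpow (5 * 12)]
  have hsx3 : s * x ^ 3 * s⁻¹ = x ^ 15 := by rw [hsxn]
  have hcomm6 : Commute s (x ^ 6) := by
    rw [commute_iff_eq]; calc s * x ^ 6 = s * x ^ 6 * s⁻¹ * s := by rw [inv_mul_cancel_right]
      _ = x ^ 6 * s := by rw [hsx6]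
  have hcomm12 : Commute s (x ^ 12) := by
    rw [commute_iff_eq]; calc s * x ^ 12 = s * x ^ 12 * s⁻¹ * s := by rw [inv_mul_cancel_right]
      _ = x ^ 12 * s := by rw [hsx12]
  have hxc : ∀ m n : ℕ, Commute (x ^ m) (x ^ n) := fun m n => (Commute.refl x).pow_pow m n
  -- `(x⁶ s)² = x¹²` and `(x³ s)·…` identities
  have hx6s_sq : (x ^ 6 * s) * (x ^ 6 * s) = x ^ 12 := by
    calc (x ^ 6 * s) * (x ^ 6 * s) = x ^ 6 * (s * x ^ 6 * s⁻¹) * (s * s) := by group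
      _ = x ^ 12 := by rw [hsx6, hs, mul_one, ← pow_add]
  ------------------------------------------------------------------
  -- STEP (3): `μ(L^{⟨x⁶⟩})` from `L^{⟨x³⟩}`, `L^{⟨x⁶,s⟩}`, `L^{⟨x⁶,x³s⟩}`, `L^{⟨x³,s⟩}`
  ------------------------------------------------------------------
  have h63 : x ^ 6 ∈ Subgroup.zpowers (x ^ 3) := by
    rw [show x ^ 6 = (x ^ 3) ^ 2 by rw [← pow_mul]]
    exact Subgroup.pow_mem _ (Subgroup.mem_zpowers _) 2
  have hμD : ∀ κE : ZpExtension ↥(fixedField (Subgroup.zpowers (x ^ 6))) p,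
      κE.IsCyclotomic → ClassicalMuVanishes κE := by
    refine classicalMuVanishes_of_isCyclotomic_of_relative_biquadratic hp2 L hp (Subgroup.zpowers (x ^ 6))
      (x := x ^ 3) (y := s) (mem_normalizer_zpowers_of_commute₆ (hxc 3 6)) (mem_normalizer_zpowers_of_commute₆ hcomm6)
      ?_ ?_ ?_ ?_ hμB₂ hμB₂' ?_
    · rw [← pow_add]; exact Subgroup.mem_zpowers _
    · rw [hs]; exact Subgroup.one_mem _
    · -- `x³ s x⁻³ s⁻¹ = x³ (s x³ s⁻¹)⁻¹ = x³ x⁻¹⁵ = (x⁶)⁻²`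
      have h1 : x ^ 3 * s * (x ^ 3)⁻¹ * s⁻¹ = x ^ 3 * (s * x ^ 3 * s⁻¹)⁻¹ := by group
      rw [h1, hsx3]
      have h2 : x ^ 3 * (x ^ 15)⁻¹ = ((x ^ 6) ^ 2)⁻¹ := by
        rw [show x ^ 15 = x ^ 12 * x ^ 3 by rw [← pow_add], mul_inv_rev, ← mul_assoc, mul_inv_cancel, one_mul,
          ← pow_mul]
      rw [h2]
      exact Subgroup.inv_mem _ (Subgroup.pow_mem _ (Subgroup.mem_zpowers _) 2)
    · exact forall_classicalMuVanishes_of_subgroup_eq₆ hp (zpowers_sup_eq_of_mem h63).symm hμS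
    · refine forall_classicalMuVanishes_of_subgroup_eq₆ hp ?_ hμB₃
      rw [zpowers_sup_eq_of_mem h63]
  ------------------------------------------------------------------
  -- STEP (2): `μ(L^{⟨x¹²⟩})` from `L^{⟨x⁶⟩}`, `L^{⟨x¹²,s⟩}`, `L^{⟨x⁶s⟩}`, `L^{⟨x⁶,s⟩}`
  ------------------------------------------------------------------
  have h126 : x ^ 12 ∈ Subgroup.zpowers (x ^ 6) := by
    rw [show x ^ 12 = (x ^ 6) ^ 2 by rw [← pow_mul]]
    exact Subgroup.pow_mem _ (Subgroup.mem_zpowers _) 2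
  have h12s : x ^ 12 ∈ Subgroup.zpowers (x ^ 6 * s) := by
    rw [← hx6s_sq]
    exact Subgroup.mul_mem _ (Subgroup.mem_zpowers _) (Subgroup.mem_zpowers _)
  have hμM : ∀ κE : ZpExtension ↥(fixedField (Subgroup.zpowers (x ^ 12))) p,
      κE.IsCyclotomic → ClassicalMuVanishes κE := by
    refine classicalMuVanishes_of_isCyclotomic_of_relative_biquadratic hp2 L hp (Subgroup.zpowers (x ^ 12))
      (x := x ^ 6) (y := s) (mem_normalizer_zpowers_of_commute₆ (hxc 6 12)) (mem_normalizer_zpowers_of_commute₆ hcomm12)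
      ?_ ?_ ?_ ?_ hμB₁ ?_ ?_
    · rw [← pow_add]; exact Subgroup.mem_zpowers _
    · rw [hs]; exact Subgroup.one_mem _
    · -- `x⁶ s x⁻⁶ s⁻¹ = 1`
      have h1 : x ^ 6 * s * (x ^ 6)⁻¹ * s⁻¹ = x ^ 6 * (s * x ^ 6 * s⁻¹)⁻¹ := by group
      rw [h1, hsx6, mul_inv_cancel]
      exact Subgroup.one_mem _
    · exact forall_classicalMuVanishes_of_subgroup_eq₆ hp (zpowers_sup_eq_of_mem h126).symm hμD
    · exact forall_classicalMuVanishes_of_subgroup_eq₆ hp (zpowers_sup_eq_of_mem h12s).symm hμB₁'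
    · refine forall_classicalMuVanishes_of_subgroup_eq₆ hp ?_ hμB₂
      rw [zpowers_sup_eq_of_mem h126]
  ------------------------------------------------------------------
  -- STEP (1): `μ(L)` from `L^{⟨x¹²⟩}`, `L^{⟨s⟩}`, `L^{⟨x¹²s⟩} ≅ L^{⟨s⟩}`, `L^{⟨x¹²,s⟩}`
  ------------------------------------------------------------------
  -- `x¹² s = x³ s x⁻³`
  have hconj : Subgroup.map (MulAut.conj (x ^ 3)).toMonoidHom (Subgroup.zpowers s) = Subgroup.zpowers (x ^ 12 * s) := by
    rw [MonoidHom.map_zpowers]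
    congr 1
    change x ^ 3 * s * (x ^ 3)⁻¹ = x ^ 12 * s
    have h1 : x ^ 3 * s * (x ^ 3)⁻¹ = x ^ 3 * (s * x ^ 3 * s⁻¹)⁻¹ * s := by group
    rw [h1, hsx3]
    congr 1
    -- `x³ · x⁻¹⁵ = x⁻¹² = x¹²` using `x²⁴ = 1`
    rw [show x ^ 15 = x ^ 12 * x ^ 3 by rw [← pow_add], mul_inv_rev, ← mul_assoc, mul_inv_cancel, one_mul]
    exact inv_eq_of_mul_eq_one_right (by rw [← pow_add, hx])
  have hμPc : ∀ κE : ZpExtension ↥(fixedField (Subgroup.zpowers (x ^ 12 * s))) p,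
      κE.IsCyclotomic → ClassicalMuVanishes κE :=
    forall_classicalMuVanishes_of_conj₆ hp _ _ (x ^ 3) hconj hμP
  have hμbot : ∀ κE : ZpExtension ↥(fixedField (⊥ : Subgroup (L ≃ₐ[ℚ] L))) p,
      κE.IsCyclotomic → ClassicalMuVanishes κE := by
    refine classicalMuVanishes_of_isCyclotomic_of_relative_biquadratic hp2 L hp ⊥
      (x := x ^ 12) (y := s) (mem_normalizer_bot₆ _) (mem_normalizer_bot₆ _) ?_ ?_ ?_ ?_ ?_ ?_ ?_
    · rw [← pow_add, hx]; exact Subgroup.one_mem _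
    · rw [hs]; exact Subgroup.one_mem _
    · have h1 : x ^ 12 * s * (x ^ 12)⁻¹ * s⁻¹ = x ^ 12 * (s * x ^ 12 * s⁻¹)⁻¹ := by group
      rw [h1, hsx12, mul_inv_cancel]
      exact Subgroup.one_mem _
    · exact forall_classicalMuVanishes_of_subgroup_eq₆ hp (bot_sup_eq _).symm hμM
    · exact forall_classicalMuVanishes_of_subgroup_eq₆ hp (bot_sup_eq _).symm hμP
    · exact forall_classicalMuVanishes_of_subgroup_eq₆ hp (bot_sup_eq _).symm hμPc
    · refine forall_classicalMuVanishes_of_subgroup_eq₆ hp ?_ hμB₁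
      rw [bot_sup_eq]
  -- `L^{1} = L`
  have e : ↥(fixedField (⊥ : Subgroup (L ≃ₐ[ℚ] L))) ≃ₐ[ℚ] L :=
    (IntermediateField.equivOfEq (fixedField_bot (F := ℚ) (E := L))).trans IntermediateField.topEquiv
  exact forall_classicalMuVanishes_of_algEquiv (F := ℚ) e (not_dvd_finrank_intermediateField₆ hp _) hμbot κL hκL

end Literature.NumberTheory.IwasawaTheory

end
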